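import Literature.InformationTheory.QuantumCodes.OptimalRadius
import Summits.Ventures.QEC.Census.HGPFlattenComm
import HarnessLib

/-!
# Ventures/QEC — Decoders/HGPOptimalRadius: a KERNEL-certified hypergraph-product row `[[n, k, d]]` fixes the optimal
# correction radius `⌊(d−1)/2⌋` of its flat code — the Q4 «theorem column» bridge for family HP (PARTITION row 08)

LADDER-QEC (venture cell `qec`), rung Q4 (decoder correctness: an explicit decoder with a certified correction radius for
every census row). Input: a census theorem of qec-type-04's HGP theorem lane,
`(HGP.code (rowMatrix n₁ H₁) (rowMatrix n₂ H₂)).IsCode n k d` (Census/HGP/*.lean, KERNEL-std), and the FLAT code of the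
row, `hgpFlatCode n₁ n₂ H₁ H₂` (Census/HGPFlatten.lean: qubits `Fin (n₁n₂ + m₁m₂)`, check lists `hgpXRows` / `hgpZRows`
= the gens-file `HX` / `HZ` under qec-search-4's layout; `HGP.isCode_flat_iff`). Output:

* `HGP.hasOptimalRadius_flat` — the flat code has OPTIMAL correction radius `t = ⌊(d−1)/2⌋`
  (`CSSCode.HasOptimalRadius`, Literature/…/OptimalRadius.lean: SOME Pauli decoder, namely sector-wise minimum-weight
  decoding, corrects every Pauli error of symplectic weight `≤ t` and not every one of weight `≤ t+1`, and NO Pauli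
  decoder — no function of the syndrome whatsoever — corrects every Pauli error of weight `≤ t+1`);
* `HGP.hasOptimalRadius_flat_of_eq` — the same for the LITERAL check lists `HXl`, `HZl` once `hgpXRows … = HXl`,
  `hgpZRows … = HZl` (the per-row identities of Census/HGP/Flat*.lean), via `CSSCode.hasOptimalRadius_congr`-style
  substitution — so every row theorem of `Decoders/HGPOptimalRadiusNN.lean` transports to the literal gens object in
  one line;
* sector level, structured code (qubits `(Fin n₁ × Fin n₂) ⊕ (Fin m₁ × Fin m₂)`, no flattening): the generic
  `CSSCode.IsCode.minWeight_correctsUpToX/Z` and `CSSCode.IsCode.le_half_of_correctsUpTo_sectors` apply verbatim to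
  `isCode_<id>`; CONTROL instances below for row `HGP_rep3_x_ham3` (`[[27, 4, 3]]`, t = 1), including the literal-list
  form on the numerals of Census/HGPFlatten.lean's control identities.

TIER: CERTIFIED, KERNEL-std — pure corollaries (no `decide` except the control's `3·7 + 2·3 = 27`), axioms ⊆ {propext,
Classical.choice, Quot.sound}. HONEST FRAMING: method = theorem; explicit decoder TABLES with kernel-checked radius are
the separate kernel-table lane (`Decoders/RadiusCheckTree.lean`, `Decoders/RadiusT1Batch*.lean`); float decoders are
COMPUTED/VALIDATED rows elsewhere; nothing probabilistic here.

References: [Gottesman1997] §2.3 (chunk p0014 L3); [DelfosseNickerson2021] §3 ¶2 (chunk p0006 L8–13);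
[TillichZemor2014] Thm 7 / Thm 9 / Lemma 10 (the rows' distances, upstream).
-/

namespace Summit.Ventures.QEC.Census

open Matrix Literature.InformationTheory.QuantumCodes

/-- `CSSCode.HasOptimalRadius` depends on the two check matrices only (transport between presentations of one code,
e.g. symbolic flat lists ↔ literal numerals). [folklore] -/
theorem CSSCode.hasOptimalRadius_congr {n : ℕ} {RX RZ : Type*} [Fintype RX] [Fintype RZ] {C C' : CSSCode RX RZ (Fin n)}
    (hX : C.HX = C'.HX) (hZ : C.HZ = C'.HZ) {t : ℕ} : C.HasOptimalRadius t ↔ C'.HasOptimalRadius t := by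
  obtain ⟨A, B, h⟩ := C
  obtain ⟨A', B', h'⟩ := C'
  cases hX
  cases hZ
  rfl

/-- **Q4 theorem column for an HGP row.** If `HGP(H₁, H₂)` (structured form, `HGP.code (rowMatrix n₁ H₁) (rowMatrix n₂ H₂)`)
is an `[[n, k, d]]` code and `(d − 1)/2 = t`, then its FLAT code `hgpFlatCode n₁ n₂ H₁ H₂` (qubits `Fin n`, the gens-file
object) has optimal correction radius `t`: attained by sector-wise minimum-weight decoding, unbeatable by any Pauli
decoder. [cite: Gottesman1997, §2.3 (chunk p0014 L3)] [cite: DelfosseNickerson2021, §3 ¶2 (chunk p0006 L8–13)] -/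
theorem HGP.hasOptimalRadius_flat (n₁ n₂ : ℕ) (H₁ H₂ : List ℕ) {n k d t : ℕ}
    (h : (Summit.Ventures.QEC.HGP.code (rowMatrix n₁ H₁) (rowMatrix n₂ H₂)).IsCode n k d) (ht : (d - 1) / 2 = t) :
    (hgpFlatCode n₁ n₂ H₁ H₂).HasOptimalRadius t :=
  ((HGP.isCode_flat_iff n₁ n₂ H₁ H₂).2 h).hasOptimalRadius_of_eq ht

/-- **Literal-list form.** If the flat lists of `HGP(H₁, H₂)` evaluate to the numerals `HXl`, `HZl` (the per-row
identities of Census/HGP/Flat*.lean), then the CSS code with check matrices `rowMatrix N HXl`, `rowMatrix N HZl`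
(commutation by `flat_comm_of_eq`) has optimal correction radius `t = ⌊(d−1)/2⌋` whenever `HGP(H₁,H₂)` is `[[n, k, d]]`.
[cite: Gottesman1997, §2.3 (chunk p0014 L3)] [cite: DelfosseNickerson2021, §3 ¶2 (chunk p0006 L8–13)] -/
theorem HGP.hasOptimalRadius_flat_of_eq (n₁ n₂ : ℕ) (H₁ H₂ : List ℕ) {N : ℕ} {HXl HZl : List ℕ}
    (hN : n₁ * n₂ + H₁.length * H₂.length = N) (hX : hgpXRows n₁ n₂ H₁ H₂ = HXl) (hZ : hgpZRows n₁ n₂ H₁ H₂ = HZl)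
    {n k d t : ℕ} (h : (Summit.Ventures.QEC.HGP.code (rowMatrix n₁ H₁) (rowMatrix n₂ H₂)).IsCode n k d)
    (ht : (d - 1) / 2 = t) :
    (CSSCode.ofMatrices (rowMatrix N HXl) (rowMatrix N HZl) (flat_comm_of_eq n₁ n₂ H₁ H₂ hN hX hZ)).HasOptimalRadius t := by
  subst hN hX hZ
  exact HGP.hasOptimalRadius_flat n₁ n₂ H₁ H₂ h ht

/-! ## Controls: census row `HGP_rep3_x_ham3` (`[[27, 4, 3]]`, `isCode_HGP_rep3_x_ham3`, Census/HGP/Core1.lean) -/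

/-- CONTROL (flat code, symbolic lists): the flat code of `HGP(rep3, ham3)` has optimal correction radius `1 = ⌊(3−1)/2⌋`.
[cite: Gottesman1997, §2.3 (chunk p0014 L3)] -/
theorem hasOptimalRadius_rep3_ham3_control :
    (hgpFlatCode 3 7 [3, 6] [85, 102, 120]).HasOptimalRadius 1 :=
  HGP.hasOptimalRadius_flat 3 7 [3, 6] [85, 102, 120] HGP.isCode_HGP_rep3_x_ham3 rfl

/-- CONTROL (flat code, LITERAL gens lists of census/search-4/gens/B1core/HGP_rep3_x_ham3.json as numerals, via the control
identities `hgpXRows_rep3_ham3` / `hgpZRows_rep3_ham3` of Census/HGPFlatten.lean): optimal correction radius `1`.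
[cite: Gottesman1997, §2.3 (chunk p0014 L3)] -/
theorem hasOptimalRadius_rep3_ham3_literal_control :
    (CSSCode.ofMatrices
      (rowMatrix 27 [2097281, 4194562, 6291972, 8389640, 10487824, 12587040, 14688320, 16793728, 33587456, 50397696,
        67240960, 84150272, 101191680, 118497280])
      (rowMatrix 27 [2097237, 4194406, 8388728, 18885248, 37761792, 75512832, 18169856, 35225600, 69074944])
      (flat_comm_of_eq 3 7 [3, 6] [85, 102, 120] (by decide) hgpXRows_rep3_ham3 hgpZRows_rep3_ham3)).HasOptimalRadius 1 :=
  HGP.hasOptimalRadius_flat_of_eq 3 7 [3, 6] [85, 102, 120] (by decide) hgpXRows_rep3_ham3 hgpZRows_rep3_ham3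
    HGP.isCode_HGP_rep3_x_ham3 rfl

/-- CONTROL (structured code on qubits `(Fin 3 × Fin 7) ⊕ (Fin 2 × Fin 3)`, `X`-sector): minimum-weight `X`-decoding of
`HGP(rep3, ham3)` corrects every bit-flip pattern of weight `≤ 1`. [cite: DelfosseNickerson2021, §3 ¶2 (chunk p0006 L8–9)] -/
theorem minWeight_correctsUpToX_rep3_ham3_control :
    (Decoder.minWeight (Summit.Ventures.QEC.HGP.code (rowMatrix 3 [3, 6]) (rowMatrix 7 [85, 102, 120])).xSyndrome
        hammingNorm).CorrectsUpTo
      (Summit.Ventures.QEC.HGP.code (rowMatrix 3 [3, 6]) (rowMatrix 7 [85, 102, 120])).xSyndrome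
      ((Summit.Ventures.QEC.HGP.code (rowMatrix 3 [3, 6]) (rowMatrix 7 [85, 102, 120])).rowSpX :
        Set ((Fin 3 × Fin 7) ⊕ (Fin 2 × Fin 3) → ZMod 2)) hammingNorm 1 :=
  HGP.isCode_HGP_rep3_x_ham3.minWeight_correctsUpToX

/-- CONTROL (structured code, both sectors, tightness): no pair of sector decoders of `HGP(rep3, ham3)` both correct
every pattern of weight `≤ 2`. [cite: DelfosseNickerson2021, §3 ¶2 (chunk p0006 L12–13)] -/
theorem le_one_of_correctsUpTo_sectors_rep3_ham3_control
    {DX : Decoder (Fin 3 × Fin 3 → ZMod 2) ((Fin 3 × Fin 7) ⊕ (Fin 2 × Fin 3) → ZMod 2)}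
    {DZ : Decoder (Fin 2 × Fin 7 → ZMod 2) ((Fin 3 × Fin 7) ⊕ (Fin 2 × Fin 3) → ZMod 2)} {t : ℕ}
    (hDX : DX.CorrectsUpTo (Summit.Ventures.QEC.HGP.code (rowMatrix 3 [3, 6]) (rowMatrix 7 [85, 102, 120])).xSyndrome
      ((Summit.Ventures.QEC.HGP.code (rowMatrix 3 [3, 6]) (rowMatrix 7 [85, 102, 120])).rowSpX :
        Set ((Fin 3 × Fin 7) ⊕ (Fin 2 × Fin 3) → ZMod 2)) hammingNorm t)
    (hDZ : DZ.CorrectsUpTo (Summit.Ventures.QEC.HGP.code (rowMatrix 3 [3, 6]) (rowMatrix 7 [85, 102, 120])).zSyndrome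
      ((Summit.Ventures.QEC.HGP.code (rowMatrix 3 [3, 6]) (rowMatrix 7 [85, 102, 120])).rowSpZ :
        Set ((Fin 3 × Fin 7) ⊕ (Fin 2 × Fin 3) → ZMod 2)) hammingNorm t) : t ≤ 1 :=
  HGP.isCode_HGP_rep3_x_ham3.le_half_of_correctsUpTo_sectors hDX hDZ

end Summit.Ventures.QEC.Census
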